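import Summits.AtomisticToContinuum.Crystallization.Theorems.FrustratedLawDichotomyStrainedPatchPairTubeRec

/-!
# Strained patch · «PairTube» RECORD CELLS — numerals PARAMETRIC in the cone `(β, s)` (decomp-a2c lens-5 g84 v2; HOME-only, census-gated)

The numeral file that lands LAST in the row-1373 order `A → B → Rec → Record`.  v2 (critic row 1425 (B): «instances at the two cone levels pre-staged
so that either certg outcome lands without re-typing»): the three record cells are DEFINITIONS parametric in the cone `(β, s)` of the score-relevant
pair table `relCone 2 β s (1/25)` (`Rᴱ = 2 ≥ 9/5 + τ₀`, memo §5b (E8); site boxes at the scalar `τ₀ = 1/25`), [CORE-FAR] and the crux BY NAME are proved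
for EVERY `(β, s)`, and the cells of the certg grid of record (rows 1418 (C)(ii) / 1425 (B)) are instances by `rfl` (§2), and §3 types
the HOST-GRADED form (`relConeBy`: cone parameters read off the chart; per-host cells = one table; two-class split lemmas `tubeFloorGB_relConeBy_step[F]`, nestable): record-flat `(43/1000, 0)`
(= 1.1 × β_flat(FZ09) 0.0388, row 1397 (2)) and record-cone `(197/10000, 49/5000)` (= 1.1 × 1.49 × (0.012 + 0.006ℓ), memo §5c).  On census PASS«PAIR»
the literal of record is whichever instance passed on every host; nothing else changes. [formal bookkeeping] 0 sorry.
-/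

noncomputable section

open scoped BigOperators Classical
open Summit.AtomisticToContinuum.Crystallization.Theorems.ChargedEnergyGapNegative (eStar E3)
open Summit.AtomisticToContinuum.Crystallization.Theorems.FrustratedLawDichotomyRangeCut
open Summit.AtomisticToContinuum.Crystallization.Theorems.FrustratedLawDichotomySchurCut
open Summit.AtomisticToContinuum.Crystallization.Theorems.FrustratedLawDichotomyMotifLemmas (GoodAtScale)
open Summit.AtomisticToContinuum.Crystallization.Theorems.FrustratedLawDichotomyAveragingCut (ballAvg)
open Summit.AtomisticToContinuum.Crystallization.Theorems.FrustratedLawDichotomyExemptLocOpt (LocOptFails)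
open Summit.AtomisticToContinuum.Crystallization.Theorems.FrustratedLawDichotomyExemptSplit (SchurElasticPricingX)
open Summit.AtomisticToContinuum.Crystallization.Theorems.FrustratedLawDichotomyExemptAbsorptionRecord
open Summit.AtomisticToContinuum.Crystallization.Theorems.FrustratedLawDichotomyCollarCensus
open Summit.AtomisticToContinuum.Crystallization.Theorems.FrustratedLawDichotomyCollarCensusKappa
open Summit.AtomisticToContinuum.Crystallization.Theorems.FrustratedLawDichotomyStrainedPatchHomSplit
open Summit.AtomisticToContinuum.Crystallization.Theorems.FrustratedLawDichotomyStrainedPatchCleanCollar (CleanBall TailPenalty AnnularDefectFloor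
  DefectiveCollarFloor)
open Summit.AtomisticToContinuum.Crystallization.Theorems.FrustratedLawDichotomyStrainedPatchPhaseCut (MonoPhaseBall AnnularPhaseFloor PolyTextureFloor
  monoPhaseBall_comp_iff)
open Summit.AtomisticToContinuum.Crystallization.Theorems.FrustratedLawDichotomyStrainedPatchCoreTube (NearHomIsoAt CoreOffTubeFloor nearHomIsoAt_comp_iff)
open Summit.AtomisticToContinuum.Crystallization.Theorems.FrustratedLawDichotomyStrainedPatchCoreTubeRecord (CoreCoreRelief)
open Summit.AtomisticToContinuum.Crystallization.Theorems.FrustratedLawDichotomyStrainedPatchStrainBands (EdgeFarFloor coreOff_iff_edge_and_soft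
  softFarFloor_eighth)
open Summit.AtomisticToContinuum.Crystallization.Theorems.FrustratedLawDichotomyStrainedPatchHomIsometry (admissible_comp_iff goodAtScale_comp_iff
  dist_comp injective_comp_iff)
open Summit.AtomisticToContinuum.Crystallization.Theorems.FrustratedLawDichotomyStrainedPatchHomTubeIso (cleanBall_comp_iff ballAvg_xRec_comp)
open Summit.AtomisticToContinuum.Crystallization.Theorems.FrustratedLawDichotomyStrainedPatchChartFamilies (ChartBy FamilyLE familyLE_refl
  ChartBy.mono_t ChartBy.mono_family)
open Summit.AtomisticToContinuum.Crystallization.Theorems.FrustratedLawDichotomyStrainedPatchHostCells (TubeFloor FamilyCover FamP)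
open Summit.AtomisticToContinuum.Crystallization.Theorems.FrustratedLawDichotomyStrainedPatchQuantSlaving (ChartFam SlackTab)
open Summit.AtomisticToContinuum.Crystallization.Theorems.FrustratedLawDichotomyStrainedPatchGradedTube
open Summit.AtomisticToContinuum.Crystallization.Theorems.FrustratedLawDichotomyStrainedPatchCoverBridge
open Summit.AtomisticToContinuum.Crystallization.Theorems.FrustratedLawDichotomyAperiodicGapRecordJunctionCore
  (aperiodicFrustratedLawGap_of_homFloor_625_of_coreOff periodicFrustratedLawGap_of_homFloor_625_of_coreOff)

namespace Summit.AtomisticToContinuum.Crystallization.Theorems.FrustratedLawDichotomyStrainedPatchPairTube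

/-- (TF-GB⋆): the pair-tube E-cell at `relCone 2 β s (1/25)`, site boxes at the scalar `1/25` («PAIR-84-E»). -/
def TubeFloorGBRec (𝓘 : ChartFam) (β s : ℝ) : Prop :=
  TubeFloorGB 𝓘 (1 / 25) (constTol (1 / 25)) (relCone 2 β s (1 / 25))

/-- (K⋆) the scalar cover of record at `τ₀ = 1/25`, graded at `constTol (1/25)`. -/
def FamilyCoverGRec (𝓘₀ : ChartFam) : Prop :=
  FamilyCoverG 𝓘₀ (24 / 5) (1 / 100) (1 / 8) (1 / 25) (constTol (1 / 25))

/-- (D_GB⋆): the pair refinement residual at `relCone 2 β s (1/25)` («PAIR-84-T»). -/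
def RefineGBRec (𝓘₀ 𝓘 : ChartFam) (β s : ℝ) : Prop :=
  RefineGB 𝓘₀ 𝓘 (24 / 5) (1 / 100) (1 / 8) (1 / 25) (constTol (1 / 25)) (1 / 25) (constTol (1 / 25)) (relCone 2 β s (1 / 25))

/-- (K⋆) from the SCALAR cover of record at `1/25`. [formal bookkeeping] -/
theorem familyCoverGRec_of_cover {𝓘₀ : ChartFam} (hK : FamilyCover 𝓘₀ (24 / 5) (1 / 100) (1 / 8) (1 / 25)) : FamilyCoverGRec 𝓘₀ :=
  familyCoverG_constTol_of_cover hK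

/-- ★ [CORE-FAR] of record from the three record cells. [formal bookkeeping] -/
theorem coreOff_record_of_pairTubeRec {𝓘₀ 𝓘 : ChartFam} {β s : ℝ} (hT : TubeFloorGBRec 𝓘 β s) (hK : FamilyCoverGRec 𝓘₀) (hD : RefineGBRec 𝓘₀ 𝓘 β s) :
    CoreOffTubeFloor (63 / 10) (63 / 10) (24 / 5) (1 / 100) 0 :=
  coreOff_record_of_coarse_of_refineGB hT hK hD

/-- ★★ THE CRUX BY NAME from the record cells and the record pins (`…JunctionCore.…_625_of_coreOff`). [formal bookkeeping] -/
theorem aperiodicFrustratedLawGap_of_homFloor_625_of_pairTubeRec {εE CE DE DX β s : ℝ} {𝓘₀ 𝓘 : ChartFam}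
    (hε0 : 0 < εE) (hε1 : εE ≤ 1 / 10000) (hU : PeriodicEnergyCeiling (-(7175 / 10000))) (hDX : 0 ≤ DX)
    (hE : SchurElasticPricingX (1 / 20) (1 / 8) w₄₅ ω₄ (3 / 400) (-(7175 / 10000)) (1 / 10000) CE DE DX (LocOptFails eStar εE (3 / 2) 1))
    (hHF : HomFloor (1 / 625)) (hTP : TailPenalty (24 / 5) (1 / 1000)) (hRl : CoreCoreRelief (63 / 10) (63 / 10) (24 / 5) (1 / 100) (3 / 5000))
    (hTF : TubeFloorGBRec 𝓘 β s) (hK : FamilyCoverGRec 𝓘₀) (hDG : RefineGBRec 𝓘₀ 𝓘 β s)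
    (hF : AnnularPhaseFloor (63 / 10) (24 / 5) (63 / 10) (1 / 1000))
    (hP : PolyTextureFloor (63 / 10) (24 / 5) (1 / 1000)) (hA : AnnularDefectFloor (24 / 5) (63 / 10)) (hD : DefectiveCollarFloor (24 / 5))
    (h2 : CrowdedCoreMotifPricingCapK (1 / 1000) (9 / 5) (133 / 10) (3 / 2) (effPot w₄₅ ω₄ (3 / 400)) (-(7175 / 10000) + 3 / 400)
      (Collar (9 / 2) fun N y j => (∃ s : ℝ, 0 ≤ s ∧ s ≤ 3 / 2 ∧ NonEquilibriumCore (-(7175 / 10000)) 0 7 s (1 / 10000) N y j) ∨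
        GoodAtScale (1 / 20) (3 / 2) y j))
    (h3 : DiluteDefectMotifPricingCapK (1 / 1000) (9 / 5) (133 / 10) (3 / 2) (effPot w₄₅ ω₄ (3 / 400)) (-(7175 / 10000) + 3 / 400)
      (Collar (9 / 2) fun N y j => (∃ s : ℝ, 0 ≤ s ∧ s ≤ 3 / 2 ∧ NonEquilibriumCore (-(7175 / 10000)) 0 7 s (1 / 10000) N y j) ∨
        GoodAtScale (1 / 20) (3 / 2) y j)) :
    Summit.AtomisticToContinuum.Crystallization.Theses.FrustratedLawDichotomy.AperiodicFrustratedLawGap :=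
  aperiodicFrustratedLawGap_of_homFloor_625_of_coreOff hε0 hε1 hU hDX hE hHF hTP hRl (coreOff_record_of_pairTubeRec hTF hK hDG) hF hP hA hD h2 h3

/-- The certg grid cells of record ARE instances: record-flat `(43/1000, 0)` and record-cone `(197/10000, 49/5000)`. [formal bookkeeping] -/
theorem tubeFloorGBRec_flat_def (𝓘 : ChartFam) :
    TubeFloorGBRec 𝓘 (43 / 1000) 0 = TubeFloorGB 𝓘 (1 / 25) (constTol (1 / 25)) (relCone 2 (43 / 1000) 0 (1 / 25)) := rfl

/-- `tubeFloorGBRec_cone_def` (docstring added by the landing lane; see the module docstring). [formal bookkeeping] -/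
theorem tubeFloorGBRec_cone_def (𝓘 : ChartFam) :
    TubeFloorGBRec 𝓘 (197 / 10000) (49 / 5000) = TubeFloorGB 𝓘 (1 / 25) (constTol (1 / 25)) (relCone 2 (197 / 10000) (49 / 5000) (1 / 25)) := rfl

/-- `refineGBRec_flat_def` (docstring added by the landing lane; see the module docstring). [formal bookkeeping] -/
theorem refineGBRec_flat_def (𝓘₀ 𝓘 : ChartFam) :
    RefineGBRec 𝓘₀ 𝓘 (43 / 1000) 0 =
      RefineGB 𝓘₀ 𝓘 (24 / 5) (1 / 100) (1 / 8) (1 / 25) (constTol (1 / 25)) (1 / 25) (constTol (1 / 25)) (relCone 2 (43 / 1000) 0 (1 / 25)) := rfl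

/-- `refineGBRec_cone_def` (docstring added by the landing lane; see the module docstring). [formal bookkeeping] -/
theorem refineGBRec_cone_def (𝓘₀ 𝓘 : ChartFam) :
    RefineGBRec 𝓘₀ 𝓘 (197 / 10000) (49 / 5000) =
      RefineGB 𝓘₀ 𝓘 (24 / 5) (1 / 100) (1 / 8) (1 / 25) (constTol (1 / 25)) (1 / 25) (constTol (1 / 25)) (relCone 2 (197 / 10000) (49 / 5000) (1 / 25)) := rfl

/-- On the T-side the two record cells are INCOMPARABLE: the cone is below the flat table exactly for `ℓ ≤ (43/1000 − 197/10000)/(49/5000) = 233/98 ≈ 2.38`. -/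
theorem recordCone_flat_crossing : (197 : ℝ) / 10000 + 49 / 5000 * (233 / 98) = 43 / 1000 := by norm_num

/-! ## §3. HOST-GRADED cells (per-host numerals: critic rows 1397 (2) / 1401 / 1425 (B) «FZ62/HM62 cells owed next, one claim each»)

The record books its cells BY HOST (flat needs ×1.1: FZ09 `43/1000`, FZ62 `167/5000`, HM62 `239/10000`; memo §5c).  A pair table is read AT THE CHART
(`PairTab` takes `(M₀, z₀, c₀)`), so per-host numerals are ONE typed table whose cone parameters are functionals of the host — `relConeBy` — and the
constant cells of §2 are its constant instance (`rfl`).  [CORE-FAR] and the crux are proved for EVERY pair of functionals; a two-class host split of the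
E-cell is the lemma `tubeFloorGB_relConeBy_step` (pattern of `familyEnvelopeLaw_of_split`, …TaylorKbandMinusD §3: classes `𝓘 ∧ 𝓟` / `𝓘 ∧ ¬𝓟`, e.g.
`𝓟 = levelClass ηP`); the T-cell needs no split (one statement, the table read at the fine chart).  [formal bookkeeping] 0 sorry. -/

/-- ★ `relConeBy RE βf sf τ₀` — the score-relevant cone with parameters READ OFF THE HOST CHART `(M₀, z₀, c₀)`. -/
def relConeBy (RE : ℝ) (βf sf : (M₀ : ℕ) → (Fin M₀ → E3) → Fin M₀ → ℝ) (τ₀ : ℝ) : PairTab :=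
  fun M₀ z₀ c₀ a b => relCone RE (βf M₀ z₀ c₀) (sf M₀ z₀ c₀) τ₀ M₀ z₀ c₀ a b

/-- Constant functionals give back `relCone`. [formal bookkeeping] -/
theorem relConeBy_const (RE β s τ₀ : ℝ) : relConeBy RE (fun _ _ _ => β) (fun _ _ _ => s) τ₀ = relCone RE β s τ₀ := rfl

/-- `relConeBy` is MONOTONE in the functionals, chart by chart (from `relCone_mono`). [formal bookkeeping] -/
theorem relConeBy_mono {RE τ₀ : ℝ} {βf βf' sf sf' : (M₀ : ℕ) → (Fin M₀ → E3) → Fin M₀ → ℝ}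
    (hβ : ∀ M₀ z₀ c₀, βf M₀ z₀ c₀ ≤ βf' M₀ z₀ c₀) (hs : ∀ M₀ z₀ c₀, sf M₀ z₀ c₀ ≤ sf' M₀ z₀ c₀) (hs0 : ∀ M₀ z₀ c₀, 0 ≤ sf' M₀ z₀ c₀)
    (hcap : ∀ M₀ z₀ c₀, βf' M₀ z₀ c₀ + sf' M₀ z₀ c₀ * (9 / 2) ≤ 2 * τ₀) :
    PairLE (relConeBy RE βf sf τ₀) (relConeBy RE βf' sf' τ₀) :=
  fun M₀ z₀ c₀ a b => relCone_mono le_rfl (hβ M₀ z₀ c₀) (hs M₀ z₀ c₀) (hs0 M₀ z₀ c₀) (hcap M₀ z₀ c₀) M₀ z₀ c₀ a b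

/-- The two-class STEP functional (`x₁` on the class `𝓟`, `x₂` off it). -/
noncomputable def stepBy (𝓟 : ChartFam) (x₁ x₂ : ℝ) : (M₀ : ℕ) → (Fin M₀ → E3) → Fin M₀ → ℝ :=
  fun M₀ z₀ c₀ => if 𝓟 M₀ z₀ c₀ then x₁ else x₂

/-- `stepBy_of_pos` (docstring added by the landing lane; see the module docstring). [formal bookkeeping] -/
theorem stepBy_of_pos {𝓟 : ChartFam} {x₁ x₂ : ℝ} {M₀ : ℕ} {z₀ : Fin M₀ → E3} {c₀ : Fin M₀} (h : 𝓟 M₀ z₀ c₀) : stepBy 𝓟 x₁ x₂ M₀ z₀ c₀ = x₁ := by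
  simp [stepBy, h]

/-- `stepBy_of_neg` (docstring added by the landing lane; see the module docstring). [formal bookkeeping] -/
theorem stepBy_of_neg {𝓟 : ChartFam} {x₁ x₂ : ℝ} {M₀ : ℕ} {z₀ : Fin M₀ → E3} {c₀ : Fin M₀} (h : ¬𝓟 M₀ z₀ c₀) : stepBy 𝓟 x₁ x₂ M₀ z₀ c₀ = x₂ := by
  simp [stepBy, h]

/-- A GB-chart only reads the pair table AT ITS OWN CHART: tables that agree there are interchangeable. [formal bookkeeping] -/
theorem ChartByGB.congr_pair {𝓘 : ChartFam} {τ : ℝ} {T : SlackTab} {B B' : PairTab} {M : ℕ} {z : Fin M → E3} {c : Fin M} {M₀ : ℕ} {z₀ : Fin M₀ → E3}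
    {c₀ : Fin M₀} {e : Fin M → Fin M₀} (h : ChartByGB 𝓘 τ T B z c z₀ c₀ e) (hB : ∀ a b, B M₀ z₀ c₀ a b = B' M₀ z₀ c₀ a b) :
    ChartByGB 𝓘 τ T B' z c z₀ c₀ e :=
  ⟨h.1, fun a b ha hb => hB (e a) (e b) ▸ h.2 a b ha hb⟩

/-- … and carries its family membership into either class. [formal bookkeeping] -/
theorem ChartByGB.toClass {𝓘 𝓟 : ChartFam} {τ : ℝ} {T : SlackTab} {B : PairTab} {M : ℕ} {z : Fin M → E3} {c : Fin M} {M₀ : ℕ} {z₀ : Fin M₀ → E3}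
    {c₀ : Fin M₀} {e : Fin M → Fin M₀} (h : ChartByGB 𝓘 τ T B z c z₀ c₀ e) (hp : 𝓟 M₀ z₀ c₀) :
    ChartByGB (fun M₀ z₀ c₀ => 𝓘 M₀ z₀ c₀ ∧ 𝓟 M₀ z₀ c₀) τ T B z c z₀ c₀ e :=
  ⟨⟨⟨⟨h.1.1.1, hp⟩, h.1.1.2⟩, h.1.2⟩, h.2⟩

/-- `ChartByGB.toOffClass` (docstring added by the landing lane; see the module docstring). [formal bookkeeping] -/
theorem ChartByGB.toOffClass {𝓘 𝓟 : ChartFam} {τ : ℝ} {T : SlackTab} {B : PairTab} {M : ℕ} {z : Fin M → E3} {c : Fin M} {M₀ : ℕ} {z₀ : Fin M₀ → E3}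
    {c₀ : Fin M₀} {e : Fin M → Fin M₀} (h : ChartByGB 𝓘 τ T B z c z₀ c₀ e) (hp : ¬𝓟 M₀ z₀ c₀) :
    ChartByGB (fun M₀ z₀ c₀ => 𝓘 M₀ z₀ c₀ ∧ ¬𝓟 M₀ z₀ c₀) τ T B z c z₀ c₀ e :=
  ⟨⟨⟨⟨h.1.1.1, hp⟩, h.1.1.2⟩, h.1.2⟩, h.2⟩

/-- ★★ HOST-CLASS SPLIT of the E-cell: per-class census cells (constant cones on `𝓘 ∧ 𝓟` and on `𝓘 ∧ ¬𝓟`) ⟹ the ONE graded cell on `𝓘` with the step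
functionals (the typed form of «cells by host»). [formal bookkeeping] -/
theorem tubeFloorGB_relConeBy_step {𝓘 𝓟 : ChartFam} {τ RE τ₀ β₁ β₂ s₁ s₂ : ℝ} {T : SlackTab}
    (h₁ : TubeFloorGB (fun M₀ z₀ c₀ => 𝓘 M₀ z₀ c₀ ∧ 𝓟 M₀ z₀ c₀) τ T (relCone RE β₁ s₁ τ₀))
    (h₂ : TubeFloorGB (fun M₀ z₀ c₀ => 𝓘 M₀ z₀ c₀ ∧ ¬𝓟 M₀ z₀ c₀) τ T (relCone RE β₂ s₂ τ₀)) :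
    TubeFloorGB 𝓘 τ T (relConeBy RE (stepBy 𝓟 β₁ β₂) (stepBy 𝓟 s₁ s₂) τ₀) := by
  intro M z c M₀ z₀ c₀ e hz hcl hm hch
  by_cases hp : 𝓟 M₀ z₀ c₀
  · exact h₁ M z c M₀ z₀ c₀ e hz hcl hm ((hch.congr_pair fun a b => by simp only [relConeBy, stepBy_of_pos hp]).toClass hp)
  · exact h₂ M z c M₀ z₀ c₀ e hz hcl hm ((hch.congr_pair fun a b => by simp only [relConeBy, stepBy_of_neg hp]).toOffClass hp)

/-- The two-class step between FUNCTIONALS (`f` on the class `𝓟`, `g` off it) — nests to any finite host classification. -/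
noncomputable def stepByF (𝓟 : ChartFam) (f g : (M₀ : ℕ) → (Fin M₀ → E3) → Fin M₀ → ℝ) : (M₀ : ℕ) → (Fin M₀ → E3) → Fin M₀ → ℝ :=
  fun M₀ z₀ c₀ => if 𝓟 M₀ z₀ c₀ then f M₀ z₀ c₀ else g M₀ z₀ c₀

/-- `stepByF_of_pos` (docstring added by the landing lane; see the module docstring). [formal bookkeeping] -/
theorem stepByF_of_pos {𝓟 : ChartFam} {f g : (M₀ : ℕ) → (Fin M₀ → E3) → Fin M₀ → ℝ} {M₀ : ℕ} {z₀ : Fin M₀ → E3} {c₀ : Fin M₀} (h : 𝓟 M₀ z₀ c₀) :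
    stepByF 𝓟 f g M₀ z₀ c₀ = f M₀ z₀ c₀ := by
  simp [stepByF, h]

/-- `stepByF_of_neg` (docstring added by the landing lane; see the module docstring). [formal bookkeeping] -/
theorem stepByF_of_neg {𝓟 : ChartFam} {f g : (M₀ : ℕ) → (Fin M₀ → E3) → Fin M₀ → ℝ} {M₀ : ℕ} {z₀ : Fin M₀ → E3} {c₀ : Fin M₀} (h : ¬𝓟 M₀ z₀ c₀) :
    stepByF 𝓟 f g M₀ z₀ c₀ = g M₀ z₀ c₀ := by
  simp [stepByF, h]

/-- `stepBy` is `stepByF` between constants. [formal bookkeeping] -/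
theorem stepBy_eq_stepByF (𝓟 : ChartFam) (x₁ x₂ : ℝ) : stepBy 𝓟 x₁ x₂ = stepByF 𝓟 (fun _ _ _ => x₁) (fun _ _ _ => x₂) := rfl

/-- ★★ HOST-CLASS SPLIT, graded on both sides (NESTABLE: a `k`-class host grading is `k − 1` applications). [formal bookkeeping] -/
theorem tubeFloorGB_relConeBy_stepF {𝓘 𝓟 : ChartFam} {τ RE τ₀ : ℝ} {T : SlackTab} {βf₁ βf₂ sf₁ sf₂ : (M₀ : ℕ) → (Fin M₀ → E3) → Fin M₀ → ℝ}
    (h₁ : TubeFloorGB (fun M₀ z₀ c₀ => 𝓘 M₀ z₀ c₀ ∧ 𝓟 M₀ z₀ c₀) τ T (relConeBy RE βf₁ sf₁ τ₀))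
    (h₂ : TubeFloorGB (fun M₀ z₀ c₀ => 𝓘 M₀ z₀ c₀ ∧ ¬𝓟 M₀ z₀ c₀) τ T (relConeBy RE βf₂ sf₂ τ₀)) :
    TubeFloorGB 𝓘 τ T (relConeBy RE (stepByF 𝓟 βf₁ βf₂) (stepByF 𝓟 sf₁ sf₂) τ₀) := by
  intro M z c M₀ z₀ c₀ e hz hcl hm hch
  by_cases hp : 𝓟 M₀ z₀ c₀
  · exact h₁ M z c M₀ z₀ c₀ e hz hcl hm ((hch.congr_pair fun a b => by simp only [relConeBy, stepByF_of_pos hp]).toClass hp)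
  · exact h₂ M z c M₀ z₀ c₀ e hz hcl hm ((hch.congr_pair fun a b => by simp only [relConeBy, stepByF_of_neg hp]).toOffClass hp)

/-- A graded E-cell on a family RESTRICTS to any subfamily (antitone in `𝓘`), in particular to a host class. [formal bookkeeping] -/
theorem tubeFloorGB_relConeBy_toClass {𝓘 𝓟 : ChartFam} {τ RE τ₀ : ℝ} {T : SlackTab} {βf sf : (M₀ : ℕ) → (Fin M₀ → E3) → Fin M₀ → ℝ}
    (h : TubeFloorGB 𝓘 τ T (relConeBy RE βf sf τ₀)) : TubeFloorGB (fun M₀ z₀ c₀ => 𝓘 M₀ z₀ c₀ ∧ 𝓟 M₀ z₀ c₀) τ T (relConeBy RE βf sf τ₀) :=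
  fun M z c M₀ z₀ c₀ e hz hcl hm hch => h M z c M₀ z₀ c₀ e hz hcl hm (hch.mono_family fun _ _ _ hI => hI.1)

/-- (TF-GB⋆ by host) / (D_GB⋆ by host): the record cells with HOST-GRADED cone parameters. -/
def TubeFloorGBRecBy (𝓘 : ChartFam) (βf sf : (M₀ : ℕ) → (Fin M₀ → E3) → Fin M₀ → ℝ) : Prop :=
  TubeFloorGB 𝓘 (1 / 25) (constTol (1 / 25)) (relConeBy 2 βf sf (1 / 25))

/-- `RefineGBRecBy` (docstring added by the landing lane; see the module docstring). [formal bookkeeping] -/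
def RefineGBRecBy (𝓘₀ 𝓘 : ChartFam) (βf sf : (M₀ : ℕ) → (Fin M₀ → E3) → Fin M₀ → ℝ) : Prop :=
  RefineGB 𝓘₀ 𝓘 (24 / 5) (1 / 100) (1 / 8) (1 / 25) (constTol (1 / 25)) (1 / 25) (constTol (1 / 25)) (relConeBy 2 βf sf (1 / 25))

/-- The constant cells of §2 ARE the constant instance. [formal bookkeeping] -/
theorem tubeFloorGBRec_eq_by (𝓘 : ChartFam) (β s : ℝ) : TubeFloorGBRec 𝓘 β s = TubeFloorGBRecBy 𝓘 (fun _ _ _ => β) (fun _ _ _ => s) := rfl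

/-- `refineGBRec_eq_by` (docstring added by the landing lane; see the module docstring). [formal bookkeeping] -/
theorem refineGBRec_eq_by (𝓘₀ 𝓘 : ChartFam) (β s : ℝ) : RefineGBRec 𝓘₀ 𝓘 β s = RefineGBRecBy 𝓘₀ 𝓘 (fun _ _ _ => β) (fun _ _ _ => s) := rfl

/-- ★★★ [CORE-FAR] from the host-graded cells, and the crux BY NAME — same junction, same pins. -/
theorem coreOff_record_of_pairTubeRecBy {𝓘₀ 𝓘 : ChartFam} {βf sf : (M₀ : ℕ) → (Fin M₀ → E3) → Fin M₀ → ℝ} (hT : TubeFloorGBRecBy 𝓘 βf sf)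
    (hK : FamilyCoverGRec 𝓘₀) (hD : RefineGBRecBy 𝓘₀ 𝓘 βf sf) : CoreOffTubeFloor (63 / 10) (63 / 10) (24 / 5) (1 / 100) 0 :=
  coreOff_record_of_coarse_of_refineGB hT hK hD

/-- `aperiodicFrustratedLawGap_of_homFloor_625_of_pairTubeRecBy` (docstring added by the landing lane; see the module docstring). [formal bookkeeping] -/
theorem aperiodicFrustratedLawGap_of_homFloor_625_of_pairTubeRecBy {εE CE DE DX : ℝ} {βf sf : (M₀ : ℕ) → (Fin M₀ → E3) → Fin M₀ → ℝ} {𝓘₀ 𝓘 : ChartFam}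
    (hε0 : 0 < εE) (hε1 : εE ≤ 1 / 10000) (hU : PeriodicEnergyCeiling (-(7175 / 10000))) (hDX : 0 ≤ DX)
    (hE : SchurElasticPricingX (1 / 20) (1 / 8) w₄₅ ω₄ (3 / 400) (-(7175 / 10000)) (1 / 10000) CE DE DX (LocOptFails eStar εE (3 / 2) 1))
    (hHF : HomFloor (1 / 625)) (hTP : TailPenalty (24 / 5) (1 / 1000)) (hRl : CoreCoreRelief (63 / 10) (63 / 10) (24 / 5) (1 / 100) (3 / 5000))
    (hTF : TubeFloorGBRecBy 𝓘 βf sf) (hK : FamilyCoverGRec 𝓘₀) (hDG : RefineGBRecBy 𝓘₀ 𝓘 βf sf)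
    (hF : AnnularPhaseFloor (63 / 10) (24 / 5) (63 / 10) (1 / 1000))
    (hP : PolyTextureFloor (63 / 10) (24 / 5) (1 / 1000)) (hA : AnnularDefectFloor (24 / 5) (63 / 10)) (hD : DefectiveCollarFloor (24 / 5))
    (h2 : CrowdedCoreMotifPricingCapK (1 / 1000) (9 / 5) (133 / 10) (3 / 2) (effPot w₄₅ ω₄ (3 / 400)) (-(7175 / 10000) + 3 / 400)
      (Collar (9 / 2) fun N y j => (∃ s : ℝ, 0 ≤ s ∧ s ≤ 3 / 2 ∧ NonEquilibriumCore (-(7175 / 10000)) 0 7 s (1 / 10000) N y j) ∨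
        GoodAtScale (1 / 20) (3 / 2) y j))
    (h3 : DiluteDefectMotifPricingCapK (1 / 1000) (9 / 5) (133 / 10) (3 / 2) (effPot w₄₅ ω₄ (3 / 400)) (-(7175 / 10000) + 3 / 400)
      (Collar (9 / 2) fun N y j => (∃ s : ℝ, 0 ≤ s ∧ s ≤ 3 / 2 ∧ NonEquilibriumCore (-(7175 / 10000)) 0 7 s (1 / 10000) N y j) ∨
        GoodAtScale (1 / 20) (3 / 2) y j)) :
    Summit.AtomisticToContinuum.Crystallization.Theses.FrustratedLawDichotomy.AperiodicFrustratedLawGap :=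
  aperiodicFrustratedLawGap_of_homFloor_625_of_coreOff hε0 hε1 hU hDX hE hHF hTP hRl (coreOff_record_of_pairTubeRecBy hTF hK hDG) hF hP hA hD h2 h3

/-! ## §4. The CORE RADIUS as a dial of the T-cells only (route (F) ρ = 26/5, critic row 1439 (B); hand-2 …FallbackLever p853834)

The E-cell `TubeFloorGB` is ρ-BLIND (host tubes do not know the core radius); only the cover / refinement cells carry `(ρ, ε)`.  Hence [CORE-FAR] at ANY
core radius from the SAME E-cell: at `ρ = 26/5` this is `[CORE-FAR](24/5) ∧ RIM(24/5 → 26/5)` by `coreOffTubeFloor_of_record_of_rim` /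
`rim_of_coreOffTubeFloor` (tree …FallbackLever) — the RIM piece costs NO new E-boxes under PASS«PAIR», only the cover check of the rim class. -/

/-- (K⋆ at ρ, ε) / (D_GB⋆ by host at ρ, ε): the T-cells with the core radius and far-threshold as dials. -/
def FamilyCoverGRecAt (𝓘₀ : ChartFam) (ρ ε : ℝ) : Prop :=
  FamilyCoverG 𝓘₀ ρ ε (1 / 8) (1 / 25) (constTol (1 / 25))

/-- `RefineGBRecByAt` (docstring added by the landing lane; see the module docstring). [formal bookkeeping] -/
def RefineGBRecByAt (𝓘₀ 𝓘 : ChartFam) (ρ ε : ℝ) (βf sf : (M₀ : ℕ) → (Fin M₀ → E3) → Fin M₀ → ℝ) : Prop :=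
  RefineGB 𝓘₀ 𝓘 ρ ε (1 / 8) (1 / 25) (constTol (1 / 25)) (1 / 25) (constTol (1 / 25)) (relConeBy 2 βf sf (1 / 25))

/-- The record T-cells are the `(24/5, 1/100)` instances. [formal bookkeeping] -/
theorem familyCoverGRec_eq_at (𝓘₀ : ChartFam) : FamilyCoverGRec 𝓘₀ = FamilyCoverGRecAt 𝓘₀ (24 / 5) (1 / 100) := rfl

/-- `refineGBRecBy_eq_at` (docstring added by the landing lane; see the module docstring). [formal bookkeeping] -/
theorem refineGBRecBy_eq_at (𝓘₀ 𝓘 : ChartFam) (βf sf : (M₀ : ℕ) → (Fin M₀ → E3) → Fin M₀ → ℝ) :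
    RefineGBRecBy 𝓘₀ 𝓘 βf sf = RefineGBRecByAt 𝓘₀ 𝓘 (24 / 5) (1 / 100) βf sf := rfl

/-- `familyCoverGRecAt_of_cover` (docstring added by the landing lane; see the module docstring). [formal bookkeeping] -/
theorem familyCoverGRecAt_of_cover {𝓘₀ : ChartFam} {ρ ε : ℝ} (hK : FamilyCover 𝓘₀ ρ ε (1 / 8) (1 / 25)) : FamilyCoverGRecAt 𝓘₀ ρ ε :=
  familyCoverG_constTol_iff.2 hK

/-- ★★ [CORE-FAR] at ANY core radius `ρ` and far-threshold `ε` from the SAME host-graded E-cell. [formal bookkeeping] -/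
theorem coreOff_at_of_pairTubeRecBy {𝓘₀ 𝓘 : ChartFam} {ρ ε : ℝ} {βf sf : (M₀ : ℕ) → (Fin M₀ → E3) → Fin M₀ → ℝ} (hT : TubeFloorGBRecBy 𝓘 βf sf)
    (hK : FamilyCoverGRecAt 𝓘₀ ρ ε) (hD : RefineGBRecByAt 𝓘₀ 𝓘 ρ ε βf sf) : CoreOffTubeFloor (63 / 10) (63 / 10) ρ ε 0 :=
  coreOff_of_tubeFloorGB_of_coarse_of_refineGB hT hK hD

/-- Route (F) instance: [CORE-FAR] on the `26/5`-core, `1/100`-far. [formal bookkeeping] -/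
theorem coreOff_26_5_of_pairTubeRecBy {𝓘₀ 𝓘 : ChartFam} {βf sf : (M₀ : ℕ) → (Fin M₀ → E3) → Fin M₀ → ℝ} (hT : TubeFloorGBRecBy 𝓘 βf sf)
    (hK : FamilyCoverGRecAt 𝓘₀ (26 / 5) (1 / 100)) (hD : RefineGBRecByAt 𝓘₀ 𝓘 (26 / 5) (1 / 100) βf sf) :
    CoreOffTubeFloor (63 / 10) (63 / 10) (26 / 5) (1 / 100) 0 :=
  coreOff_at_of_pairTubeRecBy hT hK hD

end Summit.AtomisticToContinuum.Crystallization.Theorems.FrustratedLawDichotomyStrainedPatchPairTube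

end
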